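import Summits.QuantumFields.QCD.Theses.GaussianLinkFrames

/-!
# Sketch — crux-ideate round 1, ideator 2, crux `FrameAPrioriBound` (stmt-QuantumFields-17374)

First lemmas of the two idea cards `robust-kernel-rigidity` and `toric-character-minors`.
Nothing here is proved; everything must elaborate.
-/

noncomputable section

namespace Summit.QuantumFields.QCD.Cruxes.FrameAPrioriBound.Ideator2

open scoped BigOperators Matrix ComplexConjugate
open MeasureTheory Filter Literature.MathematicalPhysics.QuantumFieldTheory
  Literature.MathematicalPhysics.QuantumLattice Literature.Probability.LatticeModels

abbrev SU3 : Type := Matrix.specialUnitaryGroup (Fin 3) ℂ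

variable {L : ℕ}

/-- `H(U) − z`, `H = γ₅ D_W(U; m₀, r = 1)` (same object as in `Lines/cube_cofactor.lean`). -/
abbrev hz [NeZero L] (U : GaugeConfig 4 L SU3) (m₀ : ℝ) (z : ℂ) :
    Matrix (TorusSite 4 L × Fin 3 × Fin 4) (TorusSite 4 L × Fin 3 × Fin 4) ℂ :=
  spinorLift gammaFive * wilsonDirac (fundamentalRep (Fin 3)) U m₀ 1 -
    z • (1 : Matrix (TorusSite 4 L × Fin 3 × Fin 4) (TorusSite 4 L × Fin 3 × Fin 4) ℂ)

/-- ℓ^∞-cube of radius 2 around `x` (as in the registered line). -/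
def inCube (x v : TorusSite 4 L) : Prop :=
  ∀ μ : Fin 4, v μ = x μ ∨ v μ = x μ + 1 ∨ v μ = x μ + 2 ∨ v μ + 1 = x μ ∨ v μ + 2 = x μ

/-- the outer layer of that cube (ℓ^∞-distance exactly 2 from `x` in some coordinate). -/
def inOuterLayer (x v : TorusSite 4 L) : Prop :=
  inCube x v ∧ ∃ μ : Fin 4, v μ = x μ + 2 ∨ v μ + 2 = x μ

instance (x v : TorusSite 4 L) : Decidable (inCube x v) := by unfold inCube; infer_instance
instance (x v : TorusSite 4 L) : Decidable (inOuterLayer x v) := by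
  unfold inOuterLayer; infer_instance

/-- index set of the Dirichlet cube problem: sites of `Q₂(x)` × colour × spin. -/
abbrev CubeIdx (x : TorusSite 4 L) : Type := {v : TorusSite 4 L // inCube x v} × Fin 3 × Fin 4

/-- the embedding of cube indices into torus indices. -/
def cubeIncl (x : TorusSite 4 L) : CubeIdx x → TorusSite 4 L × Fin 3 × Fin 4 :=
  fun i => ((i.1 : TorusSite 4 L), i.2.1, i.2.2)

/-- The Dirichlet (principal-submatrix) cube operator `H_{Q₂(x)}(U) − z`. -/
abbrev hzCube [NeZero L] (x : TorusSite 4 L) (U : GaugeConfig 4 L SU3) (m₀ : ℝ) (z : ℂ) :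
    Matrix (CubeIdx x) (CubeIdx x) ℂ :=
  (hz U m₀ z).submatrix (cubeIncl x) (cubeIncl x)

/-! ## Card `robust-kernel-rigidity` -/

/-- FIRST LEMMA (card `robust-kernel-rigidity`, step 0: "semi-dark data are self-adjoint boundary
conditions").  For the compactified port pencil `𝕄 = [[H − z, iB(1+K)],[Bᴴ, 1 − K]]` of the
registered line (any Hermitian `H`, REAL `z`, any port coupling `B`, any `K`): a kernel vector
`(φ, χ)` satisfies `‖Kχ‖ = ‖χ‖`, i.e. `χ` only loads the isometric directions of `K` (for a
contraction: `KᴴKχ = χ`).  Proof: `⟨φ,(H−z)φ⟩ ∈ ℝ` equals `i⟨(1−K)χ,(1+K)χ⟩`, whose imaginary part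
is `‖χ‖² − ‖Kχ‖²`.  Consequence: the strictly contractive directions of an exterior datum never
support a robust kernel; semi-darkness is decided by a Hermitian boundary term `Γ₁ = −i(1+V)(1−V)⁻¹`
on a port subspace plus eliminations — a finite-dimensional family of SELF-ADJOINT problems. -/
def IsometricKernelReduction : Prop :=
  ∀ (n p : ℕ) (H : Matrix (Fin n) (Fin n) ℂ), H.IsHermitian →
  ∀ (z : ℝ) (B : Matrix (Fin n) (Fin p) ℂ) (K : Matrix (Fin p) (Fin p) ℂ)
    (φ : Fin n → ℂ) (χ : Fin p → ℂ),
    H *ᵥ φ - (z : ℂ) • φ + Complex.I • (B *ᵥ ((1 + K) *ᵥ χ)) = 0 →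
    Bᴴ *ᵥ φ + (1 - K) *ᵥ χ = 0 →
    star (K *ᵥ χ) ⬝ᵥ (K *ᵥ χ) = star χ ⬝ᵥ χ


/-- PROOF of the first lemma of card `robust-kernel-rigidity` (sorry-free). -/
theorem isometricKernelReduction_holds : IsometricKernelReduction := by
  intro n p H hH z B K φ χ h1 h2
  have star_self_dot_real : ∀ {q : ℕ} (v : Fin q → ℂ), star (star v ⬝ᵥ v) = star v ⬝ᵥ v :=
    fun v => (Matrix.star_dotProduct v v).symm
  have star_dot_mulVec : ∀ (w : Fin p → ℂ), star φ ⬝ᵥ (B *ᵥ w) = star (Bᴴ *ᵥ φ) ⬝ᵥ w := by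
    intro w
    rw [Matrix.star_mulVec, Matrix.conjTranspose_conjTranspose, Matrix.dotProduct_mulVec]
  set a : ℂ := star χ ⬝ᵥ χ with ha
  set c : ℂ := star (K *ᵥ χ) ⬝ᵥ (K *ᵥ χ) with hc
  set b : ℂ := star χ ⬝ᵥ (K *ᵥ χ) with hb
  have ha_real : star a = a := star_self_dot_real χ
  have hc_real : star c = c := star_self_dot_real (K *ᵥ χ)
  have hb' : star (K *ᵥ χ) ⬝ᵥ χ = star b := by
    rw [hb, Matrix.star_dotProduct]
  set s : ℂ := star φ ⬝ᵥ (H *ᵥ φ - (z : ℂ) • φ) with hs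
  have hHreal : star (star φ ⬝ᵥ (H *ᵥ φ)) = star φ ⬝ᵥ (H *ᵥ φ) := by
    calc star (star φ ⬝ᵥ (H *ᵥ φ)) = star (H *ᵥ φ) ⬝ᵥ φ := (Matrix.star_dotProduct _ _).symm
      _ = (star φ ᵥ* Hᴴ) ⬝ᵥ φ := by rw [Matrix.star_mulVec]
      _ = star φ ⬝ᵥ (Hᴴ *ᵥ φ) := (Matrix.dotProduct_mulVec _ _ _).symm
      _ = star φ ⬝ᵥ (H *ᵥ φ) := by rw [hH.eq]
  have hzreal : star (star φ ⬝ᵥ ((z : ℂ) • φ)) = star φ ⬝ᵥ ((z : ℂ) • φ) := by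
    rw [dotProduct_smul, smul_eq_mul, star_mul', star_self_dot_real φ, Complex.star_def,
      Complex.conj_ofReal]
  have hs_real : star s = s := by
    rw [hs, dotProduct_sub, star_sub, hHreal, hzreal]
  have hHφ : H *ᵥ φ - (z : ℂ) • φ = -(Complex.I • (B *ᵥ ((1 + K) *ᵥ χ))) :=
    eq_neg_of_add_eq_zero_left h1
  have hBφ : Bᴴ *ᵥ φ = -((1 - K) *ᵥ χ) := eq_neg_of_add_eq_zero_left h2
  have e_expand : star ((1 - K) *ᵥ χ) ⬝ᵥ ((1 + K) *ᵥ χ) = a + b - star b - c := by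
    rw [Matrix.sub_mulVec, Matrix.add_mulVec, Matrix.one_mulVec, star_sub, sub_dotProduct,
      dotProduct_add, dotProduct_add, hb']
    try ring
  have hs2 : s = Complex.I * (a + b - star b - c) := by
    rw [hs, hHφ, dotProduct_neg, dotProduct_smul, smul_eq_mul, star_dot_mulVec, hBφ, star_neg,
      neg_dotProduct, e_expand]
    try ring
  have hs3 : star s = -Complex.I * (star a + star b - b - star c) := by
    rw [hs2, star_mul', star_sub, star_sub, star_add, star_star, Complex.star_def, Complex.conj_I]
    try simp only [Complex.star_def]
  rw [ha_real, hc_real] at hs3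
  have key : -Complex.I * (a + star b - b - c) = Complex.I * (a + b - star b - c) := by
    rw [← hs3, hs_real, hs2]
  linear_combination (-Complex.I / 2) * key + (c - a) * Complex.I_mul_I

/-- TARGET COROLLARY of the structure theorem (card `robust-kernel-rigidity`), in Dirichlet-plus-
boundary-term form, kit-probeable: for the cube `Q₂(x)` with an ARBITRARY Hermitian boundary term
`Θ` supported on the OUTER LAYER, if `z` is an eigenvalue of `H_{Q₂(x)}(U) + Θ` for EVERY link
configuration `U` (a robust kernel = flat band over the link torus), then the `x`-rows of the
adjugate vanish identically: the robust kernel is INVISIBLE at the centre.  (The structure theorem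
says why: a robust kernel has a CORE on which the effective Schur complement is `U`-independent
modulo gauge; in a plaquette-rich region a core is interior-decoupled, hence lives in the outer
layer.)  Refutable by ONE explicit `(m₀, z, Θ)` with a robust `x`-visible kernel. -/
def CubeRobustKernelsInvisible : Prop :=
  ∀ (L : ℕ) [NeZero L], 5 ≤ L → ∀ (m₀ : ℝ), -2 ≤ m₀ → m₀ ≤ 2 → ∀ (z : ℝ), |z| ≤ 1 →
  ∀ (x : TorusSite 4 L) (Θ : Matrix (CubeIdx x) (CubeIdx x) ℂ), Θ.IsHermitian →
    (∀ i j : CubeIdx x, ¬ inOuterLayer x (i.1 : TorusSite 4 L) ∨ ¬ inOuterLayer x (j.1 : TorusSite 4 L)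
        → Θ i j = 0) →
    (∀ U : GaugeConfig 4 L SU3, (hzCube x U m₀ (z : ℂ) + Θ).det = 0) →
    ∀ (U : GaugeConfig 4 L SU3) (a : Fin 3) (i : Fin 4) (j : CubeIdx x) (hx : inCube x x),
      (hzCube x U m₀ (z : ℂ) + Θ).adjugate (⟨x, hx⟩, a, i) j = 0

/-! ## Card `toric-character-minors` -/

/-- FIRST LEMMA (card `toric-character-minors`): the extreme Laurent coefficients along a circle.
If `A₀` is invertible and `t ↦ det(A₀ + t·U₊V₊ + t⁻¹·U₋V₋)` vanishes on the whole unit circle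
(a robust kernel along one Cartan circle of one link, `U±V±` the rank-`r` hop pieces of extreme
weight), then the two EXTREME coefficients vanish: `det(V₊A₀⁻¹U₊) = 0` and `det(V₋A₀⁻¹U₋) = 0`
— explicit `r × r` "corner-propagator minors" of the `θ`-independent part.  (Sylvester:
`det(A₀ + 𝒰D(t)𝒱) = det A₀ · det(1 + D(t)𝒱A₀⁻¹𝒰)`, and the `t^{±r}` coefficients of the right
factor are the principal minors on the `±` blocks.)  Iterated over links in a lexicographic order
of Cartan directions this computes the vertex coefficients of the Newton polytope of
`W ↦ det 𝕄_Λ(W; K)` as explicit polynomials in the boundary datum `K` ALONE. -/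
def CircleExtremeCoefficients : Prop :=
  ∀ (n r : ℕ) (A₀ : Matrix (Fin n) (Fin n) ℂ) (Up Um : Matrix (Fin n) (Fin r) ℂ)
    (Vp Vm : Matrix (Fin r) (Fin n) ℂ), IsUnit A₀.det →
    (∀ θ : ℝ, (A₀ + Complex.exp (θ * Complex.I) • (Up * Vp)
        + Complex.exp (-(θ * Complex.I)) • (Um * Vm)).det = 0) →
    (Vp * A₀⁻¹ * Up).det = 0 ∧ (Vm * A₀⁻¹ * Um).det = 0

/-- the Cartan circle `diag(e^{iθ}, e^{−iθ}, 1)` in `SU(3)` acting on ONE link `e` of a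
configuration (left multiplication). -/
def circleMatrix (θ : ℝ) : Matrix (Fin 3) (Fin 3) ℂ :=
  Matrix.diagonal ![Complex.exp (θ * Complex.I), Complex.exp (-(θ * Complex.I)), 1]

/-- SECOND LEMMA (card `toric-character-minors`, the quantitative half): Fourier coefficients along
a Cartan circle bound the fibre supremum of `|det|` from BELOW — `|ĉ_k| ≤ sup_θ |det|` — so every
explicit extreme coefficient (previous lemma) is a LOWER bound for the denominator `sup_W |det|`
of the cofactor-domination ratio; stated for one link `e` of an arbitrary configuration, any
`k : ℤ`, provided the circle stays in `SU(3)` (it does: `circleMatrix θ ∈ SU(3)`, to be proved). -/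
def CircleFourierLowerBound : Prop :=
  ∀ (L : ℕ) [NeZero L] (m₀ : ℝ) (z : ℂ) (U : GaugeConfig 4 L SU3) (e : Edge 4 L) (k : ℤ) (M : ℝ),
    (∀ (θ : ℝ) (h : circleMatrix θ * ((U e : SU3) : Matrix (Fin 3) (Fin 3) ℂ) ∈
        Matrix.specialUnitaryGroup (Fin 3) ℂ),
      ‖(hz (Function.update U e ⟨_, h⟩) m₀ z).det‖ ≤ M) →
    ∀ (h : ∀ θ : ℝ, circleMatrix θ * ((U e : SU3) : Matrix (Fin 3) (Fin 3) ℂ) ∈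
        Matrix.specialUnitaryGroup (Fin 3) ℂ),
    ‖(1 / (2 * Real.pi) : ℂ) * ∫ θ in (0 : ℝ)..(2 * Real.pi),
        Complex.exp (-(k * θ * Complex.I)) *
          (hz (Function.update U e ⟨_, h θ⟩) m₀ z).det‖ ≤ M

end Summit.QuantumFields.QCD.Cruxes.FrameAPrioriBound.Ideator2
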